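import Summits.HodgeConjecture.CorCM.GysinSurface
import HarnessLib

/-!
# COR-CM model layer, part 6a (towards fact F7 `Fact_gysin`): the rational Gysin map of a morphism of smooth
# projective varieties — traces in top degree, and algebraic classes

Cell `pub-hodgecm2` (COR-CM), seat `model-1`; groundwork for row Fg7 of `BINDER-OWNERS.md` (stage-1 fact F7 `Fact_gysin`:
block-projection Gysin maps with the projection formula and base change), generalising two steps of `CorCM/GysinSurface`
(row M18) from a surface source to any source:

* `exists_tr_comp_gysinTop` — for `f : Y ⟶ X` smooth projective (dims `m`, `n`) the rational top-degree Gysin map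
  `f_! : H^{2m}(Y; ℚ) → H^{2n}(X; ℚ)` (rational complex orientations) satisfies `tr_X ∘ f_! = r • tr_Y` for the light traces
  `BettiUniverse.tr`, with `r ≠ 0` (`f_!` is injective in top degree: `f_! w ⌢ [X] = f(ℂ)_*(w ⌢ [Y])`, Poincaré duality on `Y`,
  and `f(ℂ)_*` injective on `H₀`);
* `gysinMap_mem_ratAlgebraicClasses` — `f_!` maps rational algebraic classes of codimension `p + c` on `Y` (`m = n + c`) to
  rational algebraic classes of codimension `p` on `X` (complex Gysin maps preserve Grothendieck's coniveau,
  `complexGysin_mem_supportedClasses`; rational vs complex Gysin, `complexGysin_ringChange_eq_smul_gysinMap`).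
-/

noncomputable section

open CategoryTheory
open Literature.AlgebraicTopology.SingularHomology
open Literature.AlgebraicGeometry.Motives (SchemeOver ComplexPoints IsSmoothProjective bettiCohomology)
open Literature.AlgebraicGeometry.HodgeTheory
open Literature.NumberTheory.Automorphic.PicardCM

namespace Summit.HodgeConjecture.CorCM.Model

variable {m n : ℕ} {Y X : SchemeOver ℂ}

/-- The top-degree rational Gysin map is injective: `f_! w = 0 → w = 0` (any smooth projective source). -/
theorem gysinMap_top_eq_zero (hY : IsSmoothProjective m Y) (hX : IsSmoothProjective n X) (f : Y ⟶ X)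
    {w : bettiCohomology Y (2 * m)}
    (hw : gysinMap (complexOrientationRat hY) (complexOrientationRat hX)
      (Literature.AlgebraicGeometry.Motives.AlgPoints.mapContinuous (L := ℂ) f)
      (show 2 * m + 0 = 2 * m from rfl) (show 2 * n + 0 = 2 * n from rfl) w = 0) : w = 0 := by
  have hcap := capProduct_gysinMap (μY := complexOrientationRat hY)
    (hasPoincareDuality_complexOrientationRat hX)
    (Literature.AlgebraicGeometry.Motives.AlgPoints.mapContinuous (L := ℂ) f)
    (show 2 * m + 0 = 2 * m from rfl) (show 2 * n + 0 = 2 * n from rfl) w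
  rw [hw, LinearMap.map_zero₂] at hcap
  have hzero : capProduct (show 2 * m + 0 = 2 * m from rfl) w (complexOrientationRat hY).fundamentalClass = 0 :=
    map_zero_injective hY f (X := X) (by rw [← hcap, map_zero])
  refine (hasPoincareDuality_complexOrientationRat hY (show 2 * m + 0 = 2 * m from rfl)).1 ?_
  rw [poincareDualityMap_apply, hzero, poincareDualityMap_apply, LinearMap.map_zero₂]

/-- **`tr_X ∘ f_! = r • tr_Y` with `r ≠ 0`** on the top degrees, for the light traces `BettiUniverse.tr`
(coordinate functionals on the top lines `H^{2m}(Y; ℚ)`, `H^{2n}(X; ℚ)`). -/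
theorem exists_tr_comp_gysinTop (hY : IsSmoothProjective m Y) (hX : IsSmoothProjective n X) (f : Y ⟶ X) :
    ∃ r : ℚ, r ≠ 0 ∧
      BettiUniverse.tr hX (2 * n) ∘ₗ
          gysinMap (complexOrientationRat hY) (complexOrientationRat hX)
            (Literature.AlgebraicGeometry.Motives.AlgPoints.mapContinuous (L := ℂ) f)
            (show 2 * m + 0 = 2 * m from rfl) (show 2 * n + 0 = 2 * n from rfl) =
        r • BettiUniverse.tr hY (2 * m) := by
  have h1Y : Module.finrank ℚ (bettiCohomology Y (2 * m)) = 1 := finrank_rat_top hY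
  have h1X : Module.finrank ℚ (bettiCohomology X (2 * n)) = 1 := finrank_rat_top hX
  obtain ⟨r, hr⟩ := exists_eq_smul_of_finrank_eq_one' h1Y
    (BettiUniverse.tr hX (2 * n) ∘ₗ
      gysinMap (complexOrientationRat hY) (complexOrientationRat hX)
        (Literature.AlgebraicGeometry.Motives.AlgPoints.mapContinuous (L := ℂ) f)
        (show 2 * m + 0 = 2 * m from rfl) (show 2 * n + 0 = 2 * n from rfl))
    (BettiUniverse.tr hY (2 * m)) (BettiUniverse.tr_ne_zero hY h1Y)
  refine ⟨r, ?_, hr⟩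
  have htrX : BettiUniverse.tr hX (2 * n) = (BettiUniverse.lineBasis hX (2 * n) h1X).coord 0 :=
    tr_eq_coord hX rfl h1X
  rintro rfl
  rw [zero_smul] at hr
  have hw0 : BettiUniverse.lineBasis hY (2 * m) h1Y 0 ≠ 0 := (BettiUniverse.lineBasis hY (2 * m) h1Y).ne_zero 0
  refine hw0 (gysinMap_top_eq_zero hY hX f ?_)
  have h := LinearMap.congr_fun hr (BettiUniverse.lineBasis hY (2 * m) h1Y 0)
  rw [LinearMap.zero_apply, LinearMap.comp_apply, htrX] at h
  rw [eq_coord_smul_of_basis (BettiUniverse.lineBasis hX (2 * n) h1X) (gysinMap _ _ _ _ _ _), h, zero_smul]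

/-- **Rational Gysin maps preserve rational algebraic classes, shifting the codimension by the relative dimension**:
for `f : Y ⟶ X` with `dim Y = dim X + c` and `z ∈ alg Y (p + c)`, `f_! z ∈ alg X p` (complex Gysin maps preserve the
coniveau, `complexGysin_mem_supportedClasses`; the rational Gysin map differs from the complex one by a non-zero
scalar on rational classes, `complexGysin_ringChange_eq_smul_gysinMap`). -/
theorem gysinMap_mem_ratAlgebraicClasses {c : ℕ} (hY : IsSmoothProjective (n + c) Y) (hX : IsSmoothProjective n X)
    (f : Y ⟶ X) (p q : ℕ) (ha : 2 * (p + c) + q = 2 * (n + c)) (hb : 2 * p + q = 2 * n)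
    {z : bettiCohomology Y (2 * (p + c))} (hz : z ∈ ratAlgebraicClasses Y (p + c)) :
    gysinMap (complexOrientationRat hY) (complexOrientationRat hX)
        (Literature.AlgebraicGeometry.Motives.AlgPoints.mapContinuous (L := ℂ) f) ha hb z ∈
      ratAlgebraicClasses X p := by
  rw [mem_ratAlgebraicClasses_iff, ofRatClass_eq_ringChange] at hz ⊢
  obtain ⟨u, hu, hug⟩ := complexGysin_ringChange_eq_smul_gysinMap (μ := complexOrientationFamily)
    hasPoincareDuality_complexOrientationFamily hY hX f (a := 2 * (p + c)) (b := 2 * p) (q := q) ha hb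
    (complexOrientationRat hY) (complexOrientationRat hX) (hasPoincareDuality_complexOrientationRat hX)
  have h1 : singularCohomology.ringChange (algebraMap ℚ ℂ) (ComplexPoints X) (2 * p)
        (gysinMap (complexOrientationRat hY) (complexOrientationRat hX)
          (Literature.AlgebraicGeometry.Motives.AlgPoints.mapContinuous (L := ℂ) f) ha hb z) =
      u⁻¹ • complexGysin complexOrientationFamily hY hX f
        (show 2 * (p + c) + 2 * n = 2 * p + 2 * (n + c) by ring)
        (singularCohomology.ringChange (algebraMap ℚ ℂ) (ComplexPoints Y) (2 * (p + c)) z) := by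
    rw [hug, smul_smul, inv_mul_cancel₀ hu, one_smul]
  rw [h1]
  exact Submodule.smul_mem _ _
    (complexGysin_mem_supportedClasses (gysinMap_restrictCompl_eq_zero_of_field ℂ) complexOrientationFamily
      hasPoincareDuality_complexOrientationFamily hY hX f _ (r := p + c) (s := p) (by omega) hz)

end Summit.HodgeConjecture.CorCM.Model

end
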